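import Literature.MathematicalPhysics.QuantumManyBody.BoseGasHardCrossingLines
import Literature.Analysis.Calculus.HardyPrimitive
import HarnessLib

/-!
# The Hardy step near the hard configurations

Topic `Literature/MathematicalPhysics/QuantumManyBody`, sequel of `BoseGasHardCrossingLines.lean`. For a function on the torus
`(ℝ/ℤ)^{3N}` that is ACL along almost every coordinate line with locally finite line potential energy (the setting of
`ae_eq_zero_of_mem_hardLayer_zero`), the mass in the part of the hard layer where an image pair of radius `≥ 40s` sits
within `3s` of (but not on) a hard sphere is `O(s²)` times the directional energy in the transition zone `hardZone v L s`:

* `enorm_sq_le_of_crossing` — pointwise, on a good line: `|G(t)|² ≤ (11s/L) ∫_{|x| < 11s/L} 1_{zone}|H|²` (the line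
  reaches the nearest hard sphere transversally within `|τ| < 11s` by the crossing lemma, `G` vanishes there, and
  Cauchy–Schwarz along the segment, which lies in the transition zone);
* `setLIntegral_layerA_le` — integrated: `∫_{LayerA(s)} |η|² ≤ (11s/L)(22s/L) ∑_q ∫ 1_{zone(s)} |H_q|²`.

Tagged folklore ([LSSY2005] Ch. 2 (2.1): hard cores in the standing class of interactions).
-/

noncomputable section

open MeasureTheory Set Metric Filter Topology
open scoped ENNReal Interval

namespace Literature.MathematicalPhysics.QuantumManyBody.BoseGas

-- The measure on `ℝ/ℤ` is the Haar PROBABILITY measure, as in `PeriodicFormDomain.lean`.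
attribute [local instance] formDomain_measureSpace formDomain_isProbabilityMeasure formDomain_isProbabilityMeasure_pi

variable {N : ℕ} {L : ℝ} {v : ℝ → ℝ≥0∞}

namespace HardLayerAux

/-- Cauchy–Schwarz: `(∫_S f)² ≤ |S| ∫_S f²`. [folklore] -/
theorem sq_setLIntegral_le {f : ℝ → ℝ≥0∞} {S : Set ℝ} (hf : AEMeasurable f (volume.restrict S)) :
    (∫⁻ x in S, f x) ^ 2 ≤ volume S * ∫⁻ x in S, f x ^ 2 := by
  have h := ENNReal.lintegral_mul_le_Lp_mul_Lq (volume.restrict S) Real.HolderConjugate.two_two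
    aemeasurable_const hf (f := fun _ => (1 : ℝ≥0∞))
  simp only [Pi.mul_apply, one_mul, ENNReal.one_rpow, lintegral_const, Measure.restrict_apply_univ] at h
  calc (∫⁻ x in S, f x) ^ 2 ≤ ((volume S) ^ (1 / (2 : ℝ)) * (∫⁻ x in S, f x ^ (2 : ℝ)) ^ (1 / (2 : ℝ))) ^ 2 := by
        gcongr
    _ = volume S * ∫⁻ x in S, f x ^ 2 := by
        rw [mul_pow, Literature.Analysis.Calculus.rpow_half_sq, Literature.Analysis.Calculus.rpow_half_sq]
        simp only [ENNReal.rpow_two]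

/-- Strictly monotone functions map the open segment between two points into the open segment between the images.
[folklore] -/
theorem mem_uIoo_of_strictMonoOn_or {f : ℝ → ℝ} {I : Set ℝ} (hI : OrdConnected I)
    (hf : StrictMonoOn f I ∨ StrictAntiOn f I) {a c x : ℝ} (ha : a ∈ I) (hc : c ∈ I) (hx : x ∈ uIoo a c) :
    f x ∈ uIoo (f a) (f c) := by
  rcases lt_or_ge a c with hac | hca
  · rw [uIoo_of_lt hac] at hx
    have hxI : x ∈ I := hI.out ha hc ⟨hx.1.le, hx.2.le⟩
    rcases hf with h | h
    · rw [uIoo_of_lt (h ha hc hac)]; exact ⟨h ha hxI hx.1, h hxI hc hx.2⟩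
    · rw [uIoo_of_gt (h ha hc hac)]; exact ⟨h hxI hc hx.2, h ha hxI hx.1⟩
  · rw [uIoo_of_ge hca] at hx
    have hxI : x ∈ I := hI.out hc ha ⟨hx.1.le, hx.2.le⟩
    have hca' : c < a := hx.1.trans hx.2
    rcases hf with h | h
    · rw [uIoo_of_gt (h hc ha hca')]; exact ⟨h hc hxI hx.1, h hxI ha hx.2⟩
    · rw [uIoo_of_lt (h hc ha hca')]; exact ⟨h hxI ha hx.2, h hc hxI hx.1⟩

/-- Along a strictly monotone stretch containing `0` and the crossing parameter `τ₀` (`ρ τ₀ = b`, the nearest hard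
radius to `ρ 0`), every parameter strictly between them has radius within `dist (ρ 0) b` of, but not at, a hard radius.
[folklore] -/
theorem infDist_pos_and_le_of_between {ρ : ℝ → ℝ} {I : Set ℝ} (hI : OrdConnected I)
    (hmono : StrictMonoOn ρ I ∨ StrictAntiOn ρ I) {τ₀ τ : ℝ} (h0 : (0 : ℝ) ∈ I) (hτ₀ : τ₀ ∈ I) (hτ : τ ∈ uIoo 0 τ₀)
    {b : ℝ} (hbS : b ∈ hardRad v) (hρτ₀ : ρ τ₀ = b) (hb : dist (ρ 0) b = infDist (ρ 0) (hardRad v)) :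
    0 < infDist (ρ τ) (hardRad v) ∧ infDist (ρ τ) (hardRad v) ≤ infDist (ρ 0) (hardRad v) := by
  have hmem := mem_uIoo_of_strictMonoOn_or hI hmono h0 hτ₀ hτ
  rw [hρτ₀] at hmem
  -- `ρ τ` is strictly between `ρ 0` and `b`
  have hlt : dist (ρ τ) b < dist (ρ 0) b ∧ dist (ρ 0) (ρ τ) < dist (ρ 0) b := by
    rcases le_total (ρ 0) b with h | h
    · rw [uIoo_of_le h] at hmem
      rw [Real.dist_eq, Real.dist_eq, Real.dist_eq, abs_of_nonpos (by linarith [hmem.2]), abs_of_nonpos (by linarith),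
        abs_of_nonpos (by linarith [hmem.1])]
      constructor <;> linarith [hmem.1, hmem.2]
    · rw [uIoo_of_ge h] at hmem
      rw [Real.dist_eq, Real.dist_eq, Real.dist_eq, abs_of_nonneg (by linarith [hmem.1]), abs_of_nonneg (by linarith),
        abs_of_nonneg (by linarith [hmem.2])]
      constructor <;> linarith [hmem.1, hmem.2]
  have hne : (hardRad v).Nonempty := ⟨b, hbS⟩
  constructor
  · rw [← (isClosed_hardRad (v := v)).notMem_iff_infDist_pos hne]
    intro hτS
    have h1 : infDist (ρ 0) (hardRad v) ≤ dist (ρ 0) (ρ τ) := infDist_le_dist_of_mem hτS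
    linarith [hlt.2]
  · calc infDist (ρ τ) (hardRad v) ≤ dist (ρ τ) b := infDist_le_dist_of_mem hbS
      _ ≤ dist (ρ 0) b := hlt.1.le
      _ = infDist (ρ 0) (hardRad v) := hb

end HardLayerAux

open HardLayerAux

/-! ### The pointwise Hardy bound on a good line -/

/-- **Pointwise Hardy bound at the crossing scale.** On a good line of particle `i` in direction `k` through `t`
(ACL with derivative `H`, locally finite line potential energy), let the image pair `(i, j, n)` have radius
`|y| ≥ 40 s` within `3s` of a hard radius, `|y|² ≤ 3 y_k²`, and let `b` be a nearest hard radius. Then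
`|G(t)|² ≤ (11 s / L) ∫_{|x| < 11s/L} 1_{hardZone}(fromUnitTorusN L (t + x𝐞)) |H(t + x𝐞)|² dx`. [folklore] -/
theorem enorm_sq_le_of_crossing (hL : 0 < L) (hv : Measurable v) {i j : Fin N} (hij : i ≠ j) (k : Fin 3)
    {G H : UnitAddTorus (Fin N × Fin 3) → ℂ} {t : UnitAddTorus (Fin N × Fin 3)}
    (hACL : ∀ a b : ℝ, IntervalIntegrable (fun x : ℝ => H (t + Pi.single (i, k) ((x : ℝ) : UnitAddCircle))) volume a b ∧
      G (t + Pi.single (i, k) ((b : ℝ) : UnitAddCircle)) - G (t + Pi.single (i, k) ((a : ℝ) : UnitAddCircle)) =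
        ∫ x in a..b, H (t + Pi.single (i, k) ((x : ℝ) : UnitAddCircle)))
    (hfin : ∀ a b : ℝ, ∫⁻ x in Ioo a b, periodicInteraction v L
        (fromUnitTorusN L (t + Pi.single (i, k) ((x : ℝ) : UnitAddCircle))) *
          ‖G (t + Pi.single (i, k) ((x : ℝ) : UnitAddCircle))‖ₑ ^ 2 ≠ ⊤)
    (n : Fin 3 → ℤ) {s : ℝ} (hs : 0 < s)
    (hD : 40 * s ≤ ‖fromUnitTorusN L t i - fromUnitTorusN L t j - latticeVec L n‖)
    (hk : ‖fromUnitTorusN L t i - fromUnitTorusN L t j - latticeVec L n‖ ^ 2 ≤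
      3 * ((fromUnitTorusN L t i - fromUnitTorusN L t j - latticeVec L n) k) ^ 2)
    (h3 : infDist ‖fromUnitTorusN L t i - fromUnitTorusN L t j - latticeVec L n‖ (hardRad v) ≤ 3 * s)
    {b : ℝ} (hbS : b ∈ hardRad v)
    (hb : dist ‖fromUnitTorusN L t i - fromUnitTorusN L t j - latticeVec L n‖ b =
      infDist ‖fromUnitTorusN L t i - fromUnitTorusN L t j - latticeVec L n‖ (hardRad v)) :
    ‖G t‖ₑ ^ 2 ≤ ENNReal.ofReal (11 * s / L) * ∫⁻ x in Ioo (-(11 * s / L)) (11 * s / L),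
      (hardZone v L s : Set (Config N)).indicator (1 : Config N → ℝ≥0∞)
          (fromUnitTorusN L (t + Pi.single (i, k) ((x : ℝ) : UnitAddCircle))) *
        ‖H (t + Pi.single (i, k) ((x : ℝ) : UnitAddCircle))‖ₑ ^ 2 := by
  set X : Config N := fromUnitTorusN L t with hX
  set y : Space := X i - X j - latticeVec L n with hy
  set ρ : ℝ → ℝ := fun τ => ‖y + τ • EuclideanSpace.single k (1 : ℝ)‖ with hρ
  set h : ℝ → ℂ := fun x => H (t + Pi.single (i, k) ((x : ℝ) : UnitAddCircle)) with hh
  have hρ0 : ρ 0 = ‖y‖ := by simp [hρ]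
  -- the crossing parameter
  have hb3 : |b - ‖y‖| ≤ 3 * s := by rw [abs_sub_comm, ← Real.dist_eq, hb]; exact h3
  obtain ⟨τ₀, hτ₀, hρτ₀⟩ := exists_crossing_param hs hD hk hb3
  have hyk := lt_abs_apply_of_crossing hs hD hk
  set xb : ℝ := τ₀ / L with hxb
  have hLxb : L * xb = τ₀ := by rw [hxb]; field_simp
  have hxb11 : |xb| < 11 * s / L := by
    rw [hxb, abs_div, abs_of_pos hL, div_lt_div_iff_of_pos_right hL]
    exact abs_lt.2 ⟨hτ₀.1, hτ₀.2⟩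
  -- `G` vanishes at the crossing
  have hvan : G (t + Pi.single (i, k) ((xb : ℝ) : UnitAddCircle)) = 0 := by
    refine lineRepr_eq_zero_of_crossing hL hv hij k hACL hfin n (x₀ := xb) ?_ ?_
    · rw [hLxb]; rw [hρτ₀]; exact hbS
    · rw [hLxb]
      intro h0
      have : |y k| = |τ₀| := by rw [show y k = -τ₀ by linarith, abs_neg]
      linarith [abs_lt.2 ⟨hτ₀.1, hτ₀.2⟩]
  -- `G t` is the integral of `h` over the segment
  have hGt : G t = ∫ x in xb..0, h x := by
    have h1 := (hACL xb 0).2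
    rw [hvan, sub_zero] at h1
    simpa using h1
  -- the segment lies in the transition zone
  have hzone : ∀ x ∈ uIoo xb 0, fromUnitTorusN L (t + Pi.single (i, k) ((x : ℝ) : UnitAddCircle)) ∈
      (hardZone v L s : Set (Config N)) := by
    intro x hx
    have hper := (isTorusPeriodic_mem_hardZone (N := N) v L s).apply_fromUnitTorusN_add hL t
      ((L * x) • (Pi.single i (EuclideanSpace.single k (1 : ℝ)) : Config N))
    rw [toUnitTorusN_smul_single hL.ne'] at hper
    rw [hper]
    -- the radius of the tracked pair at parameter `L x`
    have hτ : L * x ∈ uIoo 0 τ₀ := by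
      rw [← hLxb, uIoo_comm]
      rcases lt_or_ge xb 0 with hx0 | hx0
      · rw [uIoo_of_lt hx0] at hx
        rw [uIoo_of_lt (mul_neg_of_pos_of_neg hL hx0)]
        exact ⟨mul_lt_mul_of_pos_left hx.1 hL, by nlinarith [hx.2]⟩
      · rw [uIoo_of_ge hx0] at hx
        rw [uIoo_of_ge (mul_nonneg hL.le hx0)]
        exact ⟨by nlinarith [hx.1], mul_lt_mul_of_pos_left hx.2 hL⟩
    have hI : OrdConnected (Icc (-(11 * s)) (11 * s)) := ordConnected_Icc
    have h0I : (0 : ℝ) ∈ Icc (-(11 * s)) (11 * s) := ⟨by linarith, by linarith⟩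
    have hτ₀I : τ₀ ∈ Icc (-(11 * s)) (11 * s) := Ioo_subset_Icc_self hτ₀
    obtain ⟨hp, hle⟩ := infDist_pos_and_le_of_between (v := v) hI (strictMonoOn_or_strictAntiOn_of_crossing hs hD hk)
      h0I hτ₀I hτ hbS hρτ₀ (by simpa using hb)
    simp only [zero_smul, add_zero] at hle
    refine ⟨i, j, n, hij, ?_, ?_⟩
    · rwa [pairRad_add_smul_single_left L X hij k n (L * x)]
    · rw [pairRad_add_smul_single_left L X hij k n (L * x)]; exact hle.trans h3
  -- measurability of `h` on the segment
  have hI1 : Ι xb 0 = Ioc (min xb 0) (max xb 0) := rfl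
  have hI2 : uIoo xb 0 = Ioo (min xb 0) (max xb 0) := rfl
  have hhm : AEMeasurable (fun x => ‖h x‖ₑ) (volume.restrict (Ioc (min xb 0) (max xb 0))) :=
    (hI1 ▸ (hACL xb 0).1.def').aestronglyMeasurable.aemeasurable.enorm
  -- Cauchy–Schwarz along the segment
  calc ‖G t‖ₑ ^ 2 = ‖∫ x in Ioc (min xb 0) (max xb 0), h x‖ₑ ^ 2 := by
        rw [hGt, ← ofReal_norm, intervalIntegral.norm_intervalIntegral_eq, ofReal_norm, hI1]
    _ ≤ (∫⁻ x in Ioc (min xb 0) (max xb 0), ‖h x‖ₑ) ^ 2 := by gcongr; exact enorm_integral_le_lintegral_enorm _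
    _ ≤ volume (Ioc (min xb 0) (max xb 0)) * ∫⁻ x in Ioc (min xb 0) (max xb 0), ‖h x‖ₑ ^ 2 := sq_setLIntegral_le hhm
    _ ≤ ENNReal.ofReal (11 * s / L) * ∫⁻ x in Ioc (min xb 0) (max xb 0), ‖h x‖ₑ ^ 2 := by
        gcongr
        rw [Real.volume_Ioc]
        refine ENNReal.ofReal_le_ofReal ?_
        have := abs_lt.1 hxb11
        rcases le_total xb 0 with h0 | h0
        · rw [max_eq_right h0, min_eq_left h0]; linarith
        · rw [max_eq_left h0, min_eq_right h0]; linarith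
    _ = ENNReal.ofReal (11 * s / L) * ∫⁻ x in uIoo xb 0, ‖h x‖ₑ ^ 2 := by
        rw [hI2, setLIntegral_congr Ioo_ae_eq_Ioc.symm]
    _ = ENNReal.ofReal (11 * s / L) * ∫⁻ x in uIoo xb 0,
          (hardZone v L s : Set (Config N)).indicator (1 : Config N → ℝ≥0∞)
            (fromUnitTorusN L (t + Pi.single (i, k) ((x : ℝ) : UnitAddCircle))) * ‖h x‖ₑ ^ 2 := by
        congr 1
        refine setLIntegral_congr_fun measurableSet_Ioo (fun x hx => ?_)
        rw [indicator_of_mem (hzone x hx), Pi.one_apply, one_mul]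
    _ ≤ _ := by
        gcongr
        intro x hx
        have := abs_lt.1 hxb11
        rcases le_total xb 0 with h0 | h0
        · rw [uIoo_of_le h0] at hx; exact ⟨by linarith [hx.1], by linarith [hx.2]⟩
        · rw [uIoo_of_ge h0] at hx; exact ⟨by linarith [hx.1], by linarith [hx.2]⟩

/-! ### The integrated layer bound -/

/-- The part `LayerA(s)` of the hard layer (an image pair of radius `≥ 40 s` within `3s` of, but not on, a hard sphere),
pulled back to the torus, is measurable. [folklore] -/
theorem measurableSet_layerA (v : ℝ → ℝ≥0∞) (L s : ℝ) :
    MeasurableSet {t : UnitAddTorus (Fin N × Fin 3) | ∃ (i j : Fin N) (n : Fin 3 → ℤ), i ≠ j ∧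
      0 < infDist (pairRad L (fromUnitTorusN L t) i j n) (hardRad v) ∧
      infDist (pairRad L (fromUnitTorusN L t) i j n) (hardRad v) ≤ 3 * s ∧ 40 * s ≤ pairRad L (fromUnitTorusN L t) i j n} := by
  have h : {t : UnitAddTorus (Fin N × Fin 3) | ∃ (i j : Fin N) (n : Fin 3 → ℤ), i ≠ j ∧
      0 < infDist (pairRad L (fromUnitTorusN L t) i j n) (hardRad v) ∧
      infDist (pairRad L (fromUnitTorusN L t) i j n) (hardRad v) ≤ 3 * s ∧ 40 * s ≤ pairRad L (fromUnitTorusN L t) i j n} =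
      ⋃ i : Fin N, ⋃ j : Fin N, ⋃ n : Fin 3 → ℤ, {t | i ≠ j ∧
        0 < infDist (pairRad L (fromUnitTorusN L t) i j n) (hardRad v) ∧
        infDist (pairRad L (fromUnitTorusN L t) i j n) (hardRad v) ≤ 3 * s ∧ 40 * s ≤ pairRad L (fromUnitTorusN L t) i j n} := by
    ext t; simp only [mem_setOf_eq, mem_iUnion]
  rw [h]
  refine MeasurableSet.iUnion fun i => MeasurableSet.iUnion fun j => MeasurableSet.iUnion fun n => ?_
  by_cases hij : i = j
  · simp [hij]
  · simp only [hij, not_false_eq_true, true_and, ne_eq]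
    have hr : Measurable fun t : UnitAddTorus (Fin N × Fin 3) => pairRad L (fromUnitTorusN L t) i j n :=
      (continuous_pairRad L i j n).measurable.comp (measurable_fromUnitTorusN L)
    have hm : Measurable fun t : UnitAddTorus (Fin N × Fin 3) => infDist (pairRad L (fromUnitTorusN L t) i j n) (hardRad v) :=
      (continuous_infDist_pt _).measurable.comp hr
    simp only [setOf_and]
    exact (measurableSet_lt measurable_const hm).inter ((measurableSet_le hm measurable_const).inter
      (measurableSet_le measurable_const hr))

/-- **The integrated layer bound.** In the setting of `ae_eq_zero_of_mem_hardLayer_zero` (for every coordinate `q` an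
ACL representative `G_q = η` a.e. with measurable line derivative `H_q` and locally finite line potential energy, for
a.e. line), for every `s > 0`:
`∫_{LayerA(s)} |η|² ≤ (11s/L)(22s/L) ∑_q ∫ 1_{hardZone v L s}(fromUnitTorusN L t) |H_q(t)|² dt`. [folklore] -/
theorem setLIntegral_layerA_le (hL : 0 < L) (hv : Measurable v)
    {η : UnitAddTorus (Fin N × Fin 3) → ℂ} {G H : Fin N × Fin 3 → UnitAddTorus (Fin N × Fin 3) → ℂ}
    (hGη : ∀ q, G q =ᵐ[volume] η) (hHm : ∀ q, Measurable (H q))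
    (hgood : ∀ q : Fin N × Fin 3, ∀ᵐ t ∂(volume : Measure (UnitAddTorus (Fin N × Fin 3))),
      (∀ a b : ℝ, IntervalIntegrable (fun x : ℝ => H q (t + Pi.single q ((x : ℝ) : UnitAddCircle))) volume a b ∧
        G q (t + Pi.single q ((b : ℝ) : UnitAddCircle)) - G q (t + Pi.single q ((a : ℝ) : UnitAddCircle)) =
          ∫ x in a..b, H q (t + Pi.single q ((x : ℝ) : UnitAddCircle))) ∧
      (∀ a b : ℝ, ∫⁻ x in Ioo a b, periodicInteraction v L
        (fromUnitTorusN L (t + Pi.single q ((x : ℝ) : UnitAddCircle))) *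
          ‖G q (t + Pi.single q ((x : ℝ) : UnitAddCircle))‖ₑ ^ 2 ≠ ⊤))
    {s : ℝ} (hs : 0 < s) :
    ∫⁻ t in {t : UnitAddTorus (Fin N × Fin 3) | ∃ (i j : Fin N) (n : Fin 3 → ℤ), i ≠ j ∧
        0 < infDist (pairRad L (fromUnitTorusN L t) i j n) (hardRad v) ∧
        infDist (pairRad L (fromUnitTorusN L t) i j n) (hardRad v) ≤ 3 * s ∧ 40 * s ≤ pairRad L (fromUnitTorusN L t) i j n},
      ‖η t‖ₑ ^ 2 ≤
      ENNReal.ofReal (11 * s / L) * ENNReal.ofReal (22 * s / L) *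
        ∑ q : Fin N × Fin 3, ∫⁻ t, (hardZone v L s : Set (Config N)).indicator (1 : Config N → ℝ≥0∞) (fromUnitTorusN L t) *
          ‖H q t‖ₑ ^ 2 := by
  obtain ⟨Φ, hΦ⟩ : ∃ Φ : Fin N × Fin 3 → UnitAddTorus (Fin N × Fin 3) → ℝ≥0∞, ∀ q t, Φ q t =
      (hardZone v L s : Set (Config N)).indicator (1 : Config N → ℝ≥0∞) (fromUnitTorusN L t) * ‖H q t‖ₑ ^ 2 :=
    ⟨_, fun _ _ => rfl⟩
  have hΦm : ∀ q, Measurable (Φ q) := fun q => by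
    rw [show Φ q = fun t => (hardZone v L s : Set (Config N)).indicator (1 : Config N → ℝ≥0∞) (fromUnitTorusN L t) *
      ‖H q t‖ₑ ^ 2 from funext (hΦ q)]
    exact ((measurable_one.indicator (measurableSet_hardZone v L s)).comp (measurable_fromUnitTorusN L)).mul
      ((hHm q).enorm.pow_const 2)
  simp only [← hΦ]
  -- name the layer and the line integrals
  obtain ⟨A, hAdef⟩ : ∃ A : Set (UnitAddTorus (Fin N × Fin 3)), A = {t : UnitAddTorus (Fin N × Fin 3) |
      ∃ (i j : Fin N) (n : Fin 3 → ℤ), i ≠ j ∧ 0 < infDist (pairRad L (fromUnitTorusN L t) i j n) (hardRad v) ∧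
        infDist (pairRad L (fromUnitTorusN L t) i j n) (hardRad v) ≤ 3 * s ∧ 40 * s ≤ pairRad L (fromUnitTorusN L t) i j n} :=
    ⟨_, rfl⟩
  have hA : MeasurableSet A := hAdef ▸ measurableSet_layerA v L s
  rw [← hAdef]
  obtain ⟨I, hI⟩ : ∃ I : Fin N × Fin 3 → UnitAddTorus (Fin N × Fin 3) → ℝ≥0∞, ∀ q t, I q t =
      ∫⁻ x in Icc (-(11 * s / L)) (11 * s / L), Φ q (t + Pi.single q ((x : ℝ) : UnitAddCircle)) := ⟨_, fun _ _ => rfl⟩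
  have hIm : ∀ q : Fin N × Fin 3, Measurable (I q) := fun q => by
    rw [show I q = fun t => ∫⁻ x in Icc (-(11 * s / L)) (11 * s / L), Φ q (t + Pi.single q ((x : ℝ) : UnitAddCircle))
      from funext (hI q)]
    exact Measurable.lintegral_prod_right (ν := volume.restrict (Icc (-(11 * s / L)) (11 * s / L)))
      (f := fun (t : UnitAddTorus (Fin N × Fin 3)) (x : ℝ) => Φ q (t + Pi.single q ((x : ℝ) : UnitAddCircle)))
      ((hΦm q).comp (Literature.Analysis.FunctionSpaces.Torus.continuous_lineMap q).measurable)
  have hIeq : ∀ q : Fin N × Fin 3, ∫⁻ t, I q t = ENNReal.ofReal (22 * s / L) * ∫⁻ t, Φ q t := fun q => by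
    simp only [hI]
    rw [Literature.Analysis.FunctionSpaces.Torus.lintegral_lintegral_line_eq q (hΦm q)]
    congr 2
    ring
  -- the pointwise bound, a.e. on the layer
  have hall : ∀ᵐ t ∂(volume : Measure (UnitAddTorus (Fin N × Fin 3))), ∀ (i : Fin N) (k : Fin 3),
      ((∀ a b : ℝ, IntervalIntegrable (fun x : ℝ => H (i, k) (t + Pi.single (i, k) ((x : ℝ) : UnitAddCircle))) volume a b ∧
        G (i, k) (t + Pi.single (i, k) ((b : ℝ) : UnitAddCircle)) - G (i, k) (t + Pi.single (i, k) ((a : ℝ) : UnitAddCircle)) =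
          ∫ x in a..b, H (i, k) (t + Pi.single (i, k) ((x : ℝ) : UnitAddCircle))) ∧
      (∀ a b : ℝ, ∫⁻ x in Ioo a b, periodicInteraction v L
        (fromUnitTorusN L (t + Pi.single (i, k) ((x : ℝ) : UnitAddCircle))) *
          ‖G (i, k) (t + Pi.single (i, k) ((x : ℝ) : UnitAddCircle))‖ₑ ^ 2 ≠ ⊤)) ∧ G (i, k) t = η t :=
    ae_all_iff.2 fun i => ae_all_iff.2 fun k => (hgood (i, k)).and (hGη (i, k))
  have hpt : ∀ᵐ t ∂(volume : Measure (UnitAddTorus (Fin N × Fin 3))),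
      t ∈ A → ‖η t‖ₑ ^ 2 ≤ ENNReal.ofReal (11 * s / L) * ∑ q : Fin N × Fin 3, I q t := by
    filter_upwards [hall] with t ht htA
    rw [hAdef] at htA
    obtain ⟨i, j, n, hij, hpos, h3, hD⟩ := htA
    obtain ⟨k, hk⟩ := exists_norm_sq_le_three_mul_sq (fromUnitTorusN L t i - fromUnitTorusN L t j - latticeVec L n)
    have hne : (hardRad v).Nonempty := by
      by_contra h
      rw [not_nonempty_iff_eq_empty] at h
      rw [pairRad, h, infDist_empty] at hpos
      exact lt_irrefl _ hpos
    obtain ⟨b, hbS, hb⟩ := isClosed_hardRad.exists_infDist_eq_dist hne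
      ‖fromUnitTorusN L t i - fromUnitTorusN L t j - latticeVec L n‖
    obtain ⟨⟨hACL, hfin⟩, hGt⟩ := ht i k
    have h1 := enorm_sq_le_of_crossing hL hv hij k hACL hfin n hs hD hk h3 hbS hb.symm
    rw [hGt] at h1
    simp only [← hΦ] at h1
    refine h1.trans ?_
    gcongr
    calc ∫⁻ x in Ioo (-(11 * s / L)) (11 * s / L), Φ (i, k) (t + Pi.single (i, k) ((x : ℝ) : UnitAddCircle))
        ≤ I (i, k) t := by rw [hI]; exact lintegral_mono_set Ioo_subset_Icc_self
      _ ≤ ∑ q : Fin N × Fin 3, I q t :=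
          Finset.single_le_sum (f := fun q => I q t) (fun _ _ => zero_le) (Finset.mem_univ (i, k))
  -- integrate over the torus
  calc ∫⁻ t in A, ‖η t‖ₑ ^ 2 ≤ ∫⁻ t in A, ENNReal.ofReal (11 * s / L) * ∑ q : Fin N × Fin 3, I q t :=
        lintegral_mono_ae ((ae_restrict_iff' hA).2 hpt)
    _ ≤ ∫⁻ t, ENNReal.ofReal (11 * s / L) * ∑ q : Fin N × Fin 3, I q t := setLIntegral_le_lintegral _ _
    _ = ENNReal.ofReal (11 * s / L) * ∑ q : Fin N × Fin 3, ∫⁻ t, I q t := by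
        rw [lintegral_const_mul _ (Finset.measurable_sum _ fun q _ => hIm q), lintegral_finsetSum _ fun q _ => hIm q]
    _ = ENNReal.ofReal (11 * s / L) * ∑ q : Fin N × Fin 3, (ENNReal.ofReal (22 * s / L) * ∫⁻ t, Φ q t) := by
        simp only [hIeq]
    _ = _ := by rw [← Finset.mul_sum, mul_assoc]

end Literature.MathematicalPhysics.QuantumManyBody.BoseGas

end
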